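import Summits.Ventures.HodgeRepro2.T5SU11SphericalLegendreAll
import Summits.Ventures.HodgeRepro2.T5BergmanCoeffOrtho

/-!
# Laplace's first integral for the Legendre polynomials, the classical bounds `xⁿ ≤ P_n(x) ≤ (x + √(x² − 1))ⁿ`
on `[1, ∞)` read off the group, and the parity `P_n(−x) = (−1)ⁿ P_n(x)`

The functional equation `φ_{−2n} = φ_{2n+2}` turns the definition of the spherical function of parameter `−2n` into
**Laplace's first integral**

  **`P_n(cosh 2t) = ∫_K |cosh t − ū² sinh t|^{2n} du`**   (`legP_cosh_eq_integral_pow`),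

and `|cosh t − ū² sinh t|² = cosh 2t − sinh 2t · Re(u²)` (`normSq_cosh_sub_conj_sq_mul_sinh`), whose mean over `K` is
`cosh 2t` (`∫_K Re(u²) du = 0`, `integral_normSq_cosh_sub_eq`). Hence, for `x = cosh 2t ≥ 1`:

* **`xⁿ ≤ P_n(x)`** by Jensen's inequality for `y ↦ yⁿ` on `[0, ∞)` (`cosh_pow_le_legP`, `pow_le_legP`);
* **`P_n(x) ≤ (x + √(x² − 1))ⁿ = e^{2nt}`** from `|cosh t − ū² sinh t| ≤ cosh t + sinh t = e^t` for `t ≥ 0`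
  (`legP_le_exp`, `legP_le_pow`).

On the group these read **`φ_4(g)ⁿ ≤ φ_{2n+2}(g) ≤ (|a(g)| + |b(g)|)^{2n}`** (`sph_four_pow_le_sph_even`,
`sph_even_le_norm_add_pow`; `φ_4 + √(φ_4² − 1) = (|a| + |b|)²`). Together with `T5SU11SphericalLegendreAll`
(`P_n ≥ 1`, strictly increasing on `[1, ∞)`) these are the standard facts about the Legendre polynomials on `[1, ∞)`,
all obtained from the spherical functions of `SU(1,1)`. Nothing is claimed about (N).

Blind lane: Mathlib + the HodgeRepro2 prefix only; no sorry; axioms ⊆ {propext, Classical.choice,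
Quot.sound}.
-/

namespace Summit.Ventures.HodgeRepro2.T5SU11SphericalLegendreLaplace

open MeasureTheory Metric Set Filter Topology Complex
open T5PoincareDensity T5SU11Unimodular T5SU11Fibration T5SU11Cartan T5SU11OneParameter T5SU11CartanProjection
  T5HaarCircle T5BergmanCoefficient T5SU11SphericalFunction T5SU11SphericalSymmetry T5SU11SphericalBounds
  T5SU11SphericalLegendre T5SU11SphericalLegendreHigher T5SU11SphericalLegendreAll

/-! ### Parity, from the recursion -/

/-- **`P_n(−x) = (−1)ⁿ P_n(x)`** (Bonnet's recursion preserves parity). -/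
theorem legP_neg_pair (n : ℕ) (x : ℝ) :
    legP n (-x) = (-1) ^ n * legP n x ∧ legP (n + 1) (-x) = (-1) ^ (n + 1) * legP (n + 1) x := by
  induction n with
  | zero => simp
  | succ n ih =>
    refine ⟨ih.2, ?_⟩
    rw [legP_succ_succ, legP_succ_succ, ih.1, ih.2]
    have hn : ((n : ℝ) + 2) ≠ 0 := by positivity
    field_simp
    ring

/-- **`P_n(−x) = (−1)ⁿ P_n(x)`.** -/
theorem legP_neg (n : ℕ) (x : ℝ) : legP n (-x) = (-1) ^ n * legP n x := (legP_neg_pair n x).1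

/-- **`P_n(−1) = (−1)ⁿ`.** -/
theorem legP_neg_one (n : ℕ) : legP n (-1) = (-1) ^ n := by
  rw [legP_neg, legP_one, mul_one]

/-! ### The integrand -/

/-- **`|cosh t − ū² sinh t|² = cosh 2t − sinh 2t · Re(u²)`.** -/
theorem normSq_cosh_sub_conj_sq_mul_sinh (t : ℝ) (u : Circle) :
    ‖(Real.cosh t : ℂ) - (starRingEnd ℂ) (u : ℂ) ^ 2 * Real.sinh t‖ ^ 2
      = Real.cosh (2 * t) - Real.sinh (2 * t) * ((u : ℂ) ^ 2).re := by
  rw [← Complex.normSq_eq_norm_sq, Complex.normSq_sub, Complex.normSq_ofReal, Complex.normSq_mul,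
    Complex.normSq_ofReal, ← map_pow, Complex.normSq_conj, map_pow, Circle.normSq_coe, one_pow, one_mul,
    Real.cosh_two_mul, Real.sinh_two_mul]
  have e : (Real.cosh t : ℂ) * (starRingEnd ℂ) ((starRingEnd ℂ) ((u : ℂ) ^ 2) * (Real.sinh t : ℂ))
      = (Real.cosh t : ℂ) * (Real.sinh t : ℂ) * (u : ℂ) ^ 2 := by
    rw [map_mul, Complex.conj_conj, Complex.conj_ofReal]
    ring
  rw [e]
  simp only [Complex.mul_re, Complex.ofReal_re, Complex.ofReal_im, mul_zero, sub_zero, zero_mul, Complex.mul_im,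
    zero_add]
  ring

/-- `|cosh t − ū² sinh t| ≤ cosh t + sinh t = e^t` for `t ≥ 0`. -/
theorem norm_cosh_sub_conj_sq_mul_sinh_le {t : ℝ} (ht : 0 ≤ t) (u : Circle) :
    ‖(Real.cosh t : ℂ) - (starRingEnd ℂ) (u : ℂ) ^ 2 * Real.sinh t‖ ≤ Real.exp t := by
  have hs : 0 ≤ Real.sinh t := Real.sinh_nonneg_iff.mpr ht
  calc ‖(Real.cosh t : ℂ) - (starRingEnd ℂ) (u : ℂ) ^ 2 * Real.sinh t‖
      ≤ ‖(Real.cosh t : ℂ)‖ + ‖(starRingEnd ℂ) (u : ℂ) ^ 2 * Real.sinh t‖ := norm_sub_le _ _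
    _ = Real.cosh t + Real.sinh t := by
        rw [norm_mul, norm_pow, Complex.norm_conj, Circle.norm_coe, one_pow, one_mul, Complex.norm_real,
          Complex.norm_real, Real.norm_eq_abs, Real.norm_eq_abs, abs_of_pos (Real.cosh_pos t), abs_of_nonneg hs]
    _ = Real.exp t := Real.cosh_add_sinh t

section measure

variable [MeasurableSpace Circle] [BorelSpace Circle]

/-- **`P_n` has no zero on `[1, ∞)`** (`P_n ≥ 1` there, `T5SU11SphericalLegendreAll.one_le_legP`). -/
theorem legP_ne_zero_of_one_le (n : ℕ) {x : ℝ} (hx : 1 ≤ x) : legP n x ≠ 0 :=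
  (lt_of_lt_of_le one_pos (one_le_legP n hx)).ne'

/-- **`P_n(x) ≠ 0` for `x ≤ −1`** (by parity, `|P_n(x)| = P_n(−x) ≥ 1`). -/
theorem legP_ne_zero_of_le_neg_one (n : ℕ) {x : ℝ} (hx : x ≤ -1) : legP n x ≠ 0 := by
  have h := one_le_legP n (x := -x) (by linarith)
  rw [legP_neg] at h
  intro h0
  rw [h0, mul_zero] at h
  linarith

/-- **Laplace's first integral**: `P_n(cosh 2t) = ∫_K |cosh t − ū² sinh t|^{2n} du` (`φ_{−2n} = φ_{2n+2}`). -/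
theorem legP_cosh_eq_integral_pow (n : ℕ) (t : ℝ) :
    legP n (Real.cosh (2 * t))
      = ∫ u, (‖(Real.cosh t : ℂ) - (starRingEnd ℂ) (u : ℂ) ^ 2 * Real.sinh t‖ ^ 2) ^ n ∂haarCircle := by
  rw [← sph_neg_even_hyp, sph_hyp]
  refine integral_congr_ae (Filter.Eventually.of_forall fun u => ?_)
  simp only
  rw [neg_neg, show (2 * (n : ℝ)) = ((2 * n : ℕ) : ℝ) by push_cast; ring, Real.rpow_natCast, pow_mul]

/-- **`∫_K |cosh t − ū² sinh t|² du = cosh 2t`** (the mean of `Re(u²)` over `K` vanishes). -/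
theorem integral_normSq_cosh_sub_eq (t : ℝ) :
    ∫ u, ‖(Real.cosh t : ℂ) - (starRingEnd ℂ) (u : ℂ) ^ 2 * Real.sinh t‖ ^ 2 ∂haarCircle = Real.cosh (2 * t) := by
  simp_rw [normSq_cosh_sub_conj_sq_mul_sinh]
  have hint : Integrable (fun u : Circle => (u : ℂ) ^ 2) haarCircle :=
    (by fun_prop : Continuous fun u : Circle => (u : ℂ) ^ 2).integrable_of_hasCompactSupport
      (HasCompactSupport.of_compactSpace _)
  have hre : ∫ u : Circle, ((u : ℂ) ^ 2).re ∂haarCircle = 0 := by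
    have h := integral_zpow_mul_conj_zpow 2 0
    simp only [zpow_ofNat, pow_zero, map_one, mul_one, OfNat.ofNat_ne_zero, if_false] at h
    have h2 := integral_re hint
    simp only [RCLike.re_to_complex] at h2
    rw [h, Complex.zero_re] at h2
    exact h2
  have hre_int : Integrable (fun u : Circle => ((u : ℂ) ^ 2).re) haarCircle := by
    simpa only [RCLike.re_to_complex] using hint.re
  rw [integral_sub (integrable_const _) (hre_int.const_mul (Real.sinh (2 * t))), integral_const, measureReal_def,
    haarCircle_univ, ENNReal.toReal_one, one_smul, integral_const_mul, hre, mul_zero, sub_zero]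

/-! ### The classical bounds on `[1, ∞)` -/

omit [MeasurableSpace Circle] [BorelSpace Circle] in
/-- `u ↦ |cosh t − ū² sinh t|²` is continuous on `K`. -/
theorem continuous_kint_sq (t : ℝ) :
    Continuous fun u : Circle => ‖(Real.cosh t : ℂ) - (starRingEnd ℂ) (u : ℂ) ^ 2 * Real.sinh t‖ ^ 2 :=
  (continuous_kint t).pow 2

/-- **`(cosh 2t)ⁿ ≤ P_n(cosh 2t)`** — Jensen's inequality for `y ↦ yⁿ` applied to Laplace's first integral. -/
theorem cosh_pow_le_legP (n : ℕ) (t : ℝ) : Real.cosh (2 * t) ^ n ≤ legP n (Real.cosh (2 * t)) := by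
  rw [legP_cosh_eq_integral_pow, ← integral_normSq_cosh_sub_eq t]
  have hcv : ConvexOn ℝ (Ici 0) fun y : ℝ => y ^ n := convexOn_pow n
  refine hcv.map_integral_le (μ := haarCircle)
    (f := fun u : Circle => ‖(Real.cosh t : ℂ) - (starRingEnd ℂ) (u : ℂ) ^ 2 * Real.sinh t‖ ^ 2)
    (continuous_pow n).continuousOn isClosed_Ici (Filter.Eventually.of_forall fun u => mem_Ici.mpr (sq_nonneg _))
    ((continuous_kint_sq t).integrable_of_hasCompactSupport (HasCompactSupport.of_compactSpace _))
    (((continuous_kint_sq t).pow n).integrable_of_hasCompactSupport (HasCompactSupport.of_compactSpace _))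

/-- **`xⁿ ≤ P_n(x)` for `x ≥ 1`.** -/
theorem pow_le_legP (n : ℕ) {x : ℝ} (hx : 1 ≤ x) : x ^ n ≤ legP n x := by
  obtain ⟨t, -, ht⟩ := exists_cosh_two_mul_eq hx
  rw [← ht]
  exact cosh_pow_le_legP n t

/-- **`P_n(cosh 2t) ≤ e^{2nt}`** for `t ≥ 0`. -/
theorem legP_le_exp (n : ℕ) {t : ℝ} (ht : 0 ≤ t) : legP n (Real.cosh (2 * t)) ≤ Real.exp (2 * n * t) := by
  rw [legP_cosh_eq_integral_pow]
  have hb : ∀ u : Circle, (‖(Real.cosh t : ℂ) - (starRingEnd ℂ) (u : ℂ) ^ 2 * Real.sinh t‖ ^ 2) ^ n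
      ≤ Real.exp (2 * n * t) := fun u => by
    calc (‖(Real.cosh t : ℂ) - (starRingEnd ℂ) (u : ℂ) ^ 2 * Real.sinh t‖ ^ 2) ^ n
        ≤ (Real.exp t ^ 2) ^ n := by
          gcongr
          exact norm_cosh_sub_conj_sq_mul_sinh_le ht u
      _ = Real.exp (2 * n * t) := by
          rw [← pow_mul, ← Real.exp_nat_mul]
          congr 1
          push_cast
          ring
  calc ∫ u, (‖(Real.cosh t : ℂ) - (starRingEnd ℂ) (u : ℂ) ^ 2 * Real.sinh t‖ ^ 2) ^ n ∂haarCircle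
      ≤ ∫ _u : Circle, Real.exp (2 * n * t) ∂haarCircle :=
        integral_mono (((continuous_kint_sq t).pow n).integrable_of_hasCompactSupport
          (HasCompactSupport.of_compactSpace _)) (integrable_const _) hb
    _ = Real.exp (2 * n * t) := by
        rw [integral_const, measureReal_def, haarCircle_univ, ENNReal.toReal_one, one_smul]

/-- **`P_n(x) ≤ (x + √(x² − 1))ⁿ` for `x ≥ 1`.** -/
theorem legP_le_pow (n : ℕ) {x : ℝ} (hx : 1 ≤ x) : legP n x ≤ (x + Real.sqrt (x ^ 2 - 1)) ^ n := by
  obtain ⟨t, ht0, ht⟩ := exists_cosh_two_mul_eq hx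
  have hs : Real.sqrt (x ^ 2 - 1) = Real.sinh (2 * t) := by
    rw [← ht, show Real.cosh (2 * t) ^ 2 - 1 = Real.sinh (2 * t) ^ 2 by
      have := Real.cosh_sq (2 * t); linarith]
    exact Real.sqrt_sq (Real.sinh_nonneg_iff.mpr (by linarith))
  rw [hs, ← ht, Real.cosh_add_sinh, ← Real.exp_nat_mul]
  refine (legP_le_exp n ht0).trans (le_of_eq ?_)
  congr 1
  ring

/-! ### On the group: `φ_4ⁿ ≤ φ_{2n+2} ≤ (|a| + |b|)^{2n}` -/

/-- **`φ_4(g)ⁿ ≤ φ_{2n+2}(g)`** for every `g` (`P_n(x) ≥ xⁿ` at `x = φ_4(g) ≥ 1`). -/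
theorem sph_four_pow_le_sph_even (n : ℕ) (g : SU11) : sph 4 g ^ n ≤ sph (2 * (n : ℝ) + 2) g := by
  rw [sph_even_eq_sph_four]
  exact pow_le_legP n (one_le_sph_hyp_of_two_le (by norm_num) _ |>.trans_eq (sph_eq_sph_hyp_cartanT 4 g).symm)

/-- `√(φ_4(g)² − 1) = 2|a(g)||b(g)|` (`φ_4 = |a|² + |b|²`, `|a|² − |b|² = 1`). -/
theorem sqrt_sph_four_sq_sub_one (g : SU11) :
    Real.sqrt (sph 4 g ^ 2 - 1) = 2 * ‖mat g 0 0‖ * ‖mat g 0 1‖ := by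
  have h := normSq_sub_normSq g
  rw [Complex.normSq_eq_norm_sq, Complex.normSq_eq_norm_sq] at h
  rw [sph_four_eq_add, show (‖mat g 0 0‖ ^ 2 + ‖mat g 0 1‖ ^ 2) ^ 2 - 1 = (2 * ‖mat g 0 0‖ * ‖mat g 0 1‖) ^ 2 by
    nlinarith [h]]
  exact Real.sqrt_sq (by positivity)

/-- **`φ_{2n+2}(g) ≤ (|a(g)| + |b(g)|)^{2n}`** for every `g` (`P_n(x) ≤ (x + √(x² − 1))ⁿ` at `x = φ_4(g)`, and
`φ_4 + √(φ_4² − 1) = (|a| + |b|)²`). -/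
theorem sph_even_le_norm_add_pow (n : ℕ) (g : SU11) :
    sph (2 * (n : ℝ) + 2) g ≤ (‖mat g 0 0‖ + ‖mat g 0 1‖) ^ (2 * n) := by
  rw [sph_even_eq_sph_four, pow_mul]
  have h1 : 1 ≤ sph 4 g := (one_le_sph_hyp_of_two_le (by norm_num) _).trans_eq (sph_eq_sph_hyp_cartanT 4 g).symm
  refine (legP_le_pow n h1).trans (le_of_eq ?_)
  rw [sqrt_sph_four_sq_sub_one, sph_four_eq_add]
  ring

end measure

end Summit.Ventures.HodgeRepro2.T5SU11SphericalLegendreLaplace
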